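import Summits.BirchSwinnertonDyer.BirchSwinnertonDyer.Theorems.UniversalToricDescentResidualGrowthOfRankOneMu
import Literature.NumberTheory.EllipticCurves.IwasawaSelmerCoinvariantGrowthProofs
import Literature.NumberTheory.EllipticCurves.IwasawaSelmerDualProofs
import Mathlib.Algebra.Module.ZMod
import Mathlib.Algebra.Field.ZMod
import Mathlib.LinearAlgebra.Basis.VectorSpace
import Mathlib.LinearAlgebra.FreeModule.Basic
import Mathlib.FieldTheory.Finiteness
import Mathlib.Algebra.CharP.Lemmas
import HarnessLib

/-!
# The residual duality count `#Sel_∞[p, ω_n] ≤ #(X/(p, ω_n)X)` and K2_res from the structure of `X`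

Support file for crux `stmt-BirchSwinnertonDyer-24737` (`TwinAlgMuZeroAtThree`, line `beta-road` v7, stub
`stub_residualCorankLeOneMultOfBeta` = K2_res ∣ β; brick E8 of the LEAD's STUB BRIEF, with E7 = `…ResidualGrowthOfRankOne(Mu)`).

* §1 a general counting lemma: for a character map `toDual : X → Hom(S, A)` separating the points of `S`, a submodule `N ≤ X` with
  `X/N` finite and killed by `p`, and a set `T ⊆ S` of `p`-torsion classes orthogonal to `N`: `#T ≤ #(X/N)` (the characters
  `s ↦ (x_i ↦ ⟨x_i, s⟩)` on lifts `x_i` of an `𝔽_p`-basis of `X/N`, with values in `A[p]`, separate `T`);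
* §2 for the Selmer dual pair `D : SelmerDualData W κ γ` (`X = X(E/K_∞) ≅ Hom(Sel_{p^∞}(E/K_∞), ℚ/ℤ)`):
  `{s : p s = 0, conj_{γ^{pⁿ}} s = s}` is orthogonal to `(p, (1+T)^{pⁿ} − 1)·X`, and `(p, (1+T)^{pⁿ} − 1) = (p, T^{pⁿ})` in `Λ`;
* §3 **`natCard_setOf_pTorsion_conj_le_of_rank_one`**: if `X` is finitely generated of rank one with `μ(X_tors) = 0` then
  `#{s ∈ Sel_{p^∞}(E/K_∞) : p s = 0, conj_{γ^{pⁿ}} s = s} ≤ p^{pⁿ + C}` for all `n` — the conclusion of K2_res / K2_res ∣ β from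
  the Howard-type structure statement (E7 + E8 of the brief).

References: Greenberg, LNM 1716 (1999) §1 (PDF pp. 60–62); Washington §13.2; Mazur 1972 §6.
-/

set_option linter.dupNamespace false
set_option autoImplicit false

noncomputable section
open scoped Classical
open PowerSeries

namespace Summit.BirchSwinnertonDyer.BirchSwinnertonDyer.Theorems.UniversalToricDescentSelmerResidualDualityCount

open Literature.NumberTheory.EllipticCurves Literature.NumberTheory.EllipticCurves.IwasawaAlgebra WeierstrassCurve
open Summit.BirchSwinnertonDyer.BirchSwinnertonDyer.Theorems.UniversalToricDescentResidualGrowthOfRankOne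

universe u

variable {p : ℕ} [hp : Fact p.Prime]

/-! ## §1 Counting `p`-torsion classes by characters on an `𝔽_p`-basis -/

/-- **Character count.** Let `toDual : X → Hom(S, A)` separate the points of `S`, let `N ≤ X` be a submodule with `X/N`
finite and killed by `p`, and let `T ⊆ S` consist of `p`-torsion classes orthogonal to `N`. Then `#T ≤ #(X/N)`: the map
`s ↦ (⟨x_i, s⟩)_i ∈ A[p]^d` over lifts `x_i` of an `𝔽_p`-basis of `X/N` is injective on `T`, and `#A[p] ≤ p`.
[cite: Washington1997, §13.2] [cite: GreenbergLNM1716, §1 (PDF p. 62)] -/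
theorem natCard_le_of_dual {X S A Q : Type*} [AddCommGroup X] [AddCommGroup S] [AddCommGroup A] [AddCommGroup Q]
    [Module (ZMod p) Q] [Finite Q]
    (toDual : X →+ (S →+ A)) (hsep : ∀ s : S, (∀ x : X, toDual x s = 0) → s = 0)
    (π : X →+ Q) (hπ : Function.Surjective π) (T : Set S)
    (hN : ∀ s ∈ T, ∀ y : X, π y = 0 → toDual y s = 0) (hT : ∀ s ∈ T, p • s = 0)
    [Finite {a : A // p • a = 0}] (hA : Nat.card {a : A // p • a = 0} ≤ p) :
    Nat.card T ≤ Nat.card Q := by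
  obtain ⟨⟨ι, b⟩⟩ := Module.Free.exists_basis (R := ZMod p) (M := Q)
  haveI : Finite ι := Finite.of_injective (fun i ↦ b i) b.injective
  haveI : Fintype ι := Fintype.ofFinite ι
  set d := Nat.card ι with hd
  have hcardQ : Nat.card Q = p ^ d := by
    rw [Nat.card_congr b.equivFun.toEquiv, Nat.card_fun, Nat.card_zmod]
  choose x hx using fun i : ι ↦ hπ (b i)
  -- every `y` is congruent mod `ker π` to a `ℕ`-combination of the `x i`
  have hdecomp : ∀ y : X, ∃ c : ι → ℕ, π (y - ∑ i, c i • x i) = 0 := by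
    intro y
    refine ⟨fun i ↦ (b.repr (π y) i).val, ?_⟩
    rw [map_sub, sub_eq_zero, map_sum]
    simp_rw [map_nsmul, hx]
    conv_lhs => rw [← b.sum_repr (π y)]
    refine Finset.sum_congr rfl fun i _ ↦ ?_
    rw [← Nat.cast_smul_eq_nsmul (ZMod p), ZMod.natCast_zmod_val]
  -- the character values on the lifts, in `A[p]`
  let Φ : T → (ι → {a : A // p • a = 0}) := fun s i ↦
    ⟨toDual (x i) (s : S), by rw [← map_nsmul, hT s s.2, map_zero]⟩
  have hΦ : Function.Injective Φ := by
    intro s s' h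
    have hi : ∀ i, toDual (x i) (s : S) = toDual (x i) (s' : S) := fun i ↦ by
      have := congr_fun h i
      exact congrArg Subtype.val this
    have key : ∀ y : X, toDual y (s : S) = toDual y (s' : S) := by
      intro y
      obtain ⟨c, hc⟩ := hdecomp y
      have e : y = (y - ∑ i, c i • x i) + ∑ i, c i • x i := (sub_add_cancel y _).symm
      have h1 : toDual.flip (s : S) y = toDual.flip (s' : S) y := by
        rw [e, map_add, map_add, map_sum, map_sum]
        congr 1
        · rw [AddMonoidHom.flip_apply, AddMonoidHom.flip_apply, hN s s.2 _ hc, hN s' s'.2 _ hc]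
        · refine Finset.sum_congr rfl fun i _ ↦ ?_
          rw [map_nsmul, map_nsmul, AddMonoidHom.flip_apply, AddMonoidHom.flip_apply, hi]
      simpa only [AddMonoidHom.flip_apply] using h1
    apply Subtype.ext
    rw [← sub_eq_zero]
    exact hsep _ fun y ↦ by rw [map_sub, key, sub_self]
  calc Nat.card T ≤ Nat.card (ι → {a : A // p • a = 0}) := Nat.card_le_card_of_injective Φ hΦ
    _ = Nat.card {a : A // p • a = 0} ^ d := by rw [Nat.card_fun]
    _ ≤ p ^ d := Nat.pow_le_pow_left hA d
    _ = Nat.card Q := hcardQ.symm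

/-! ## §2 The Selmer dual pair: orthogonality of `Sel_∞[p, ω_n]` to `(p, ω_n)·X` -/

section Selmer

variable {K : Type u} [Field K] [NumberField K] {W : WeierstrassCurve K} {κ : ZpExtension K p}
  {γ : Field.absoluteGaloisGroup K} (D : SelmerDualData W κ γ)

/-- `((1+T)^m · x)(s) = x(conj_{γ}^m s)` (iterate `toDual_T_smul`). [cite: GreenbergLNM1716, §1 p. 60] -/
theorem toDual_one_add_X_pow_smul (m : ℕ) (x : D.X) (s : W.selmerInfty κ) :
    D.toDual (((1 : IwasawaAlgebra p) + PowerSeries.X) ^ m • x) s = D.toDual x (((W.conjSelmerInfty κ γ) ^ m) s) := by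
  induction m generalizing x with
  | zero => simp only [pow_zero, one_smul, AddMonoid.End.one_apply]
  | succ m ih =>
    rw [pow_succ, mul_smul, ih, add_smul, one_smul, map_add, AddMonoidHom.add_apply, pow_succ', AddMonoid.End.coe_mul,
      Function.comp_apply]
    have hT := D.toDual_T_smul x (((W.conjSelmerInfty κ γ) ^ m) s)
    change D.toDual ((PowerSeries.X : IwasawaAlgebra p) • x) (((W.conjSelmerInfty κ γ) ^ m) s) =
      D.toDual x ((W.conjSelmerInfty κ γ) (((W.conjSelmerInfty κ γ) ^ m) s)) -
        D.toDual x (((W.conjSelmerInfty κ γ) ^ m) s) at hT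
    rw [hT, add_sub_cancel]

/-- **Orthogonality.** If `p·s = 0` and `conj_{γ^{pⁿ}} s = s` then every character in `(p, (1+T)^{pⁿ} − 1)·X` kills `s`
(`(C c·x)(s) = c̄·x(s)` on `p`-torsion classes, `((1+T)^{pⁿ}·x)(s) = x(conj_{γ^{pⁿ}} s)`).
[cite: GreenbergLNM1716, §1 (PDF pp. 60–62)] [cite: Washington1997, §13.2] -/
theorem toDual_eq_zero_of_mem_smul_top (n : ℕ) {s : W.selmerInfty κ} (hps : p • s = 0)
    (hγs : W.conjH1 p κ.kerSubgroup (γ ^ p ^ n) (s : W.subgroupH1 p κ.kerSubgroup) = s) {y : D.X}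
    (hy : y ∈ (Ideal.span {PowerSeries.C (p : ℤ_[p]),
      ((1 : IwasawaAlgebra p) + PowerSeries.X) ^ (p ^ n) - 1} • (⊤ : Submodule (IwasawaAlgebra p) D.X))) :
    D.toDual y s = 0 := by
  -- `conj^{pⁿ} s = s` as an equation in `Sel_∞`
  have hconj : ((W.conjSelmerInfty κ γ) ^ (p ^ n)) s = s :=
    Subtype.ext (by rw [W.coe_conjSelmerInfty_pow_apply]; exact hγs)
  have hps1 : p ^ 1 • s = 0 := by rw [pow_one]; exact hps
  -- the two generators kill `s` against every `x`
  have hC : ∀ x : D.X, D.toDual (PowerSeries.C (p : ℤ_[p]) • x) s = 0 := by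
    intro x
    rw [D.toDual_C_smul (p : ℤ_[p]) x s 1 hps1, map_natCast,
      (ZMod.natCast_eq_zero_iff p (p ^ 1)).mpr (by rw [pow_one]), ZMod.val_zero, zero_smul]
  have hω : ∀ x : D.X, D.toDual ((((1 : IwasawaAlgebra p) + PowerSeries.X) ^ (p ^ n) - 1) • x) s = 0 := by
    intro x
    rw [sub_smul, one_smul, map_sub, AddMonoidHom.sub_apply, toDual_one_add_X_pow_smul, hconj, sub_self]
  refine Submodule.smul_induction_on hy (fun r hr z _ ↦ ?_) (fun a b ha hb ↦ by rw [map_add, AddMonoidHom.add_apply, ha, hb, add_zero])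
  rw [Ideal.mem_span_pair] at hr
  obtain ⟨u, v, rfl⟩ := hr
  rw [add_smul, map_add, AddMonoidHom.add_apply, mul_comm u, mul_smul, hC, mul_comm v, mul_smul, hω, add_zero]

omit [NumberField K] in
/-- `(p, (1+T)^{pⁿ} − 1) = (p, T^{pⁿ})` in `Λ` (binomial theorem mod `p`). [folklore] -/
theorem span_C_one_add_X_pow_sub_one_eq (n : ℕ) :
    Ideal.span {PowerSeries.C (p : ℤ_[p]), ((1 : IwasawaAlgebra p) + PowerSeries.X) ^ (p ^ n) - 1} =
      Ideal.span {PowerSeries.C (p : ℤ_[p]), (PowerSeries.X : IwasawaAlgebra p) ^ (p ^ n)} := by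
  obtain ⟨r, hr⟩ := exists_add_pow_prime_pow_eq hp.out (1 : IwasawaAlgebra p) PowerSeries.X n
  have hCp : (p : IwasawaAlgebra p) = PowerSeries.C (p : ℤ_[p]) := by rw [map_natCast]
  have hω : ((1 : IwasawaAlgebra p) + PowerSeries.X) ^ (p ^ n) - 1 =
      (PowerSeries.X : IwasawaAlgebra p) ^ (p ^ n) + (PowerSeries.X * r) * PowerSeries.C (p : ℤ_[p]) := by
    rw [hr, one_pow, ← hCp]; ring
  rw [hω, Ideal.span_pair_comm, Ideal.span_pair_add_mul_right, Ideal.span_pair_comm]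

end Selmer

/-! ## §3 K2_res from the structure of `X` -/

section Structure

variable {K : Type u} [Field K] [NumberField K] {W : WeierstrassCurve K} {κ : ZpExtension K p}
  {γ : Field.absoluteGaloisGroup K} (D : SelmerDualData W κ γ)

/-- **The residual duality count**: `#{s ∈ Sel_{p^∞}(E/K_∞) : p s = 0, conj_{γ^{pⁿ}} s = s} ≤ #(X ⧸ (p, T^{pⁿ})X)` for `X = D.X`
finitely generated (so that the quotient is finite). [cite: GreenbergLNM1716, §1 (PDF pp. 60–62)] [cite: Washington1997, §13.2] -/
theorem natCard_setOf_pTorsion_conj_le_natCard_quotient [Module.Finite (IwasawaAlgebra p) D.X] (n : ℕ) :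
    Nat.card {s : W.selmerInfty κ |
        p • s = 0 ∧ W.conjH1 p κ.kerSubgroup (γ ^ p ^ n) (s : W.subgroupH1 p κ.kerSubgroup) = s} ≤
      Nat.card (D.X ⧸ (Ideal.span {PowerSeries.C (p : ℤ_[p]), (PowerSeries.X : IwasawaAlgebra p) ^ (p ^ n)} •
        (⊤ : Submodule (IwasawaAlgebra p) D.X))) := by
  set J : Ideal (IwasawaAlgebra p) :=
    Ideal.span {PowerSeries.C (p : ℤ_[p]), (PowerSeries.X : IwasawaAlgebra p) ^ (p ^ n)} with hJ
  -- `X/JX` is finite (`#Λ/J = p^{pⁿ}`) and killed by `p`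
  have hN : 1 ≤ p ^ n := Nat.one_le_pow _ _ hp.out.pos
  haveI : Finite (IwasawaAlgebra p ⧸ J) := Nat.finite_of_card_ne_zero (by
    rw [Summit.BirchSwinnertonDyer.BirchSwinnertonDyer.Theorems.UniversalToricDescentEisensteinSplitControl.natCard_lambda_quotient_span_C_X_pow
      p hN]
    exact pow_ne_zero _ hp.out.ne_zero)
  haveI : Finite (D.X ⧸ (J • (⊤ : Submodule (IwasawaAlgebra p) D.X))) :=
    Submodule.finite_quotient_smul J Module.Finite.fg_top
  have hCp : (p : IwasawaAlgebra p) = PowerSeries.C (p : ℤ_[p]) := by rw [map_natCast]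
  have hQ : ∀ q : D.X ⧸ (J • (⊤ : Submodule (IwasawaAlgebra p) D.X)), p • q = 0 := by
    intro q
    obtain ⟨y, rfl⟩ := Submodule.mkQ_surjective _ q
    rw [← map_nsmul, Submodule.mkQ_apply, Submodule.Quotient.mk_eq_zero, ← Nat.cast_smul_eq_nsmul (IwasawaAlgebra p),
      hCp]
    exact Submodule.smul_mem_smul (Ideal.subset_span (Set.mem_insert _ _)) Submodule.mem_top
  -- `A[p]` for `A = ℚ/ℤ`
  obtain ⟨hAfin, hA⟩ := IwasawaDual.finite_and_natCard_addCircle_torsion_le (n := p) hp.out.pos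
  haveI : Finite {a : AddCircle (1 : ℚ) // p • a = 0} := hAfin.to_subtype
  have hA' : Nat.card {a : AddCircle (1 : ℚ) // p • a = 0} ≤ p := hA
  letI : Module (ZMod p) (D.X ⧸ (J • (⊤ : Submodule (IwasawaAlgebra p) D.X))) := AddCommGroup.zmodModule hQ
  refine natCard_le_of_dual D.toDual (fun s hs ↦ ?_) (J • (⊤ : Submodule (IwasawaAlgebra p) D.X)).mkQ.toAddMonoidHom
    (Submodule.mkQ_surjective _) _ (fun s hs y hy ↦ ?_) (fun s hs ↦ hs.1) hA'
  · -- characters separate points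
    by_contra h
    obtain ⟨χ, hχ⟩ := CharacterModule.exists_character_apply_ne_zero_of_ne_zero h
    obtain ⟨x, rfl⟩ := D.bijective.2 χ
    exact hχ (hs x)
  · have hy' : y ∈ J • (⊤ : Submodule (IwasawaAlgebra p) D.X) := by
      rw [LinearMap.toAddMonoidHom_coe, Submodule.mkQ_apply, Submodule.Quotient.mk_eq_zero] at hy
      exact hy
    rw [hJ, ← span_C_one_add_X_pow_sub_one_eq] at hy'
    exact toDual_eq_zero_of_mem_smul_top D n hs.1 hs.2 hy'

/-- **K2_res from the structure of `X(E/K_∞)`** (E7 + E8 of the K2 ∣ β brief): if `X = D.X` is finitely generated over `Λ` of rank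
one with `μ(X_tors) = 0` (the output of Howard's Kolyvagin-system argument with an indivisible class), then
`#{s ∈ Sel_{p^∞}(E/K_∞) : p s = 0, conj_{γ^{pⁿ}} s = s} ≤ p^{pⁿ + C}` for some `C` and every `n` — the conclusion of the
stub `stub_residualCorankLeOneMultOfBeta` of line `beta-road` v7. [cite: GreenbergLNM1716, §1 (PDF pp. 60–62)]
[cite: Washington1997, §13.2] [cite: Howard2004HeegnerKolyvagin, Thm. 2.2.10] -/
theorem natCard_setOf_pTorsion_conj_le_of_rank_one [Module.Finite (IwasawaAlgebra p) D.X]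
    (hrank : Module.rank (IwasawaAlgebra p) D.X = 1)
    (hμ : muInvariant p ↥(Submodule.torsion (IwasawaAlgebra p) D.X) = 0) :
    ∃ C : ℕ, ∀ n : ℕ, Nat.card {s : W.selmerInfty κ |
        p • s = 0 ∧ W.conjH1 p κ.kerSubgroup (γ ^ p ^ n) (s : W.subgroupH1 p κ.kerSubgroup) = s} ≤ p ^ (p ^ n + C) := by
  obtain ⟨C, hC⟩ := residual_growth_of_rank_one_of_muInvariant_eq_zero (M := D.X) hrank hμ
  refine ⟨C, fun n ↦ (natCard_setOf_pTorsion_conj_le_natCard_quotient D n).trans (le_trans (le_of_eq ?_) (hC n))⟩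
  -- `X/JX ≅ (X/pX)/T^{pⁿ}(X/pX)` for `J = (p, T^{pⁿ}) = (p) + (T^{pⁿ})`
  set J : Ideal (IwasawaAlgebra p) :=
    Ideal.span {PowerSeries.C (p : ℤ_[p]), (PowerSeries.X : IwasawaAlgebra p) ^ (p ^ n)} with hJ
  set 𝔠 : Ideal (IwasawaAlgebra p) := Ideal.span {(PowerSeries.X : IwasawaAlgebra p) ^ (p ^ n)} with h𝔠
  set A : Submodule (IwasawaAlgebra p) D.X := augIdealP p • ⊤ with hAdef
  have hJsup : J = augIdealP p ⊔ 𝔠 := by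
    rw [hJ, Ideal.span_insert]
    rfl
  have hB : (𝔠 • (⊤ : Submodule (IwasawaAlgebra p) (D.X ⧸ A))) = (𝔠 • (⊤ : Submodule (IwasawaAlgebra p) D.X)).map A.mkQ := by
    rw [Submodule.map_smul'', Submodule.map_top, Submodule.range_mkQ]
  have hsup : A ⊔ 𝔠 • (⊤ : Submodule (IwasawaAlgebra p) D.X) = J • ⊤ := by
    rw [hAdef, ← Submodule.sup_smul, ← hJsup]
  have e : ((D.X ⧸ A) ⧸ (𝔠 • (⊤ : Submodule (IwasawaAlgebra p) (D.X ⧸ A)))) ≃ₗ[IwasawaAlgebra p]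
      D.X ⧸ (J • (⊤ : Submodule (IwasawaAlgebra p) D.X)) :=
    (Submodule.quotEquivOfEq _ _ hB).trans
      ((Submodule.quotientQuotientEquivQuotientSup A (𝔠 • ⊤)).trans (Submodule.quotEquivOfEq _ _ hsup))
  exact Nat.card_congr e.symm.toEquiv

end Structure

end Summit.BirchSwinnertonDyer.BirchSwinnertonDyer.Theorems.UniversalToricDescentSelmerResidualDualityCount

end
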